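import Literature.AlgebraicGeometry.Frobenioids.NumberFieldLocalizationCategories
import Literature.AlgebraicGeometry.Frobenioids.NumberFieldLocalizations
import Literature.AlgebraicGeometry.Frobenioids.NumberFieldLocalizationsAut
import Literature.AlgebraicGeometry.Frobenioids.NumberFieldLocalizationsMono
import Mathlib.SetTheory.Cardinal.Finite
import Mathlib.Data.Nat.Prime.Basic
import HarnessLib

/-!
# Frobenioids II, Proposition 1.5 for the categories of Example 1.4 (assembly glue)

Mochizuki, *The geometry of Frobenioids II: poly-Frobenioids*, Kyushu J. Math. **62** (2008)
401–460, §1, Example 1.4 / Proposition 1.5, author's text pp. 12–15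
[cite: MochizukiFrdII2008, Prop. 1.5 pp.13-15].

The generic files `NumberFieldLocalizations*.lean` prove Proposition 1.5 for an abstract functor
`π : E₀ ⥤ P₀` under explicit hypotheses; this file spells out the PRINTED case `π = E₀ → P₀` of
Example 1.4 (`NFLocCat.toP₀ G D`, `G = Gal(F̃/F)`, `D = D_v`) and records, as named obligations, the
properties of that concrete functor which the printed proof uses and which are NOT among the items of
Example 1.4 (ii) (referee PASS-C2, C2-Fg):
* `ToP₀EssSurj` — every object of `P₀` occurs as the `P`-component of an object of `E₀`;
* `ToP₀HomReconstruction` — the bijection of Prop. 1.5 (i) for `E₀ → P₀` itself, "the easily verified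
  observation that such a bijection exists when `P → P₀` is the identity functor on `P₀`" (p. 14);
* `PHasTrivialFactorizations` — the consequence of "`D_v` trivial or of prime order" used in (ix).
Like `ToP₀ArrowwiseEssSurj`, the first two hold for PROFINITE `G` and CLOSED `D` (open subgroups of
`D` extend to open subgroups of `G`) and can FAIL for a general topological group (e.g. `G = ℚ`
discrete, `D = ℤ`: `Q₀ = {pt}`); they are predicates in `(G, D)`, to be discharged under those
hypotheses.  Given them (and `ToP₀Faithful`, `ToP₀ArrowwiseEssSurj`, `ETotallyEpimorphic` of
Example 1.4 (ii)), Proposition 1.5 (i), (ii), (iii), (iv) [first bijection and "`P` slim ⇒ `E` slim"],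
(v), (vi), (vii) [repaired form], (ix) [factorisation clause] hold VERBATIM for `E := P ×_{P₀} E₀` —
the theorems below are one-line instances of the generic ones.  Nothing here bears on [IUTchIII].
-/

namespace Literature.AlgebraicGeometry.Frobenioids

open CategoryTheory

universe v' u' u

namespace NFLocCat

variable (G : Type u) [Group G] [TopologicalSpace G] (D : Subgroup G)

/-! ### The assembly obligations on `E₀ → P₀` -/

/-- OBLIGATION (used by Prop. 1.5 (ii)–(v); holds for profinite `G`, closed `D`): `E₀ → P₀` is
essentially surjective — every connected `D_v`-set `P` embeds `D_v`-equivariantly into the restriction of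
a connected `Gal(F̃/F)`-set (every finite extension of `F_v` inside `F̃_v` is a completion of a finite
subextension of `F̃/F`). [cite: MochizukiFrdII2008, Ex. 1.4 (ii) p.13] -/
def ToP₀EssSurj : Prop := (toP₀ G D).EssSurj

/-- OBLIGATION (Prop. 1.5 (i), proof, p. 14: "the easily verified observation that such a bijection
exists when `P → P₀` is the identity functor on `P₀`"; holds for profinite `G`, closed `D`): `P₀` is
reconstructed from `E₀` by inverting the `P₀`-isomorphisms (`NFLoc.HomReconstruction`, surjectivity +
common refinement). [cite: MochizukiFrdII2008, Prop. 1.5 (i) p.14] -/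
def ToP₀HomReconstruction : Prop := NFLoc.HomReconstruction (toP₀ G D)

/-- OBLIGATION (Prop. 1.5 (ix), proof, p. 15): if `D_v` is trivial or of prime order, then "if
`α ∘ β` is any composite morphism of `P₀`, then either `α` or `β` is an isomorphism" — typed as the
implication from the hypothesis on `D` to `NFLoc.HasTrivialFactorizations P₀`.
[cite: MochizukiFrdII2008, Prop. 1.5 (ix) p.15] -/
def PHasTrivialFactorizations : Prop :=
  (D = ⊥ ∨ (Nat.card D).Prime) → NFLoc.HasTrivialFactorizations (PCat G D)

/-! ### Proposition 1.5 for `E := P ×_{P₀} E₀`, `E₀ → P₀` as in Example 1.4 -/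

section Instances

variable {G D}
variable {P : Type u'} [Category.{v'} P] (Φ : P ⥤ PCat G D)

/-- FrdII Prop. 1.5 (i) for Example 1.4's `E₀ → P₀`: `E → P` is faithful and arrow-wise essentially
surjective, and `P` is reconstructed from `E` by inverting the `P`-isomorphisms — modulo the Ex. 1.4 (ii)
facts `ToP₀Faithful`, `ToP₀ArrowwiseEssSurj` and the obligation `ToP₀HomReconstruction`.
[cite: MochizukiFrdII2008, Prop. 1.5 (i) p.13] -/
theorem prop15_i (hF : ToP₀Faithful G D) (hA : ToP₀ArrowwiseEssSurj G D)
    (hR : ToP₀HomReconstruction G D) :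
    (NFLoc.toP Φ (toP₀ G D)).Faithful ∧ IsArrowwiseEssSurj (NFLoc.toP Φ (toP₀ G D)) ∧
      NFLoc.HomReconstruction (NFLoc.toP Φ (toP₀ G D)) := by
  haveI : (toP₀ G D).Faithful := hF
  exact ⟨NFLoc.toP_faithful, NFLoc.isArrowwiseEssSurj_toP hA, NFLoc.homReconstruction_toP hR⟩

/-- FrdII Prop. 1.5 (ii) for Example 1.4's `E₀ → P₀`: `P` is connected iff `E` is — modulo
`ToP₀EssSurj`, `ToP₀HomReconstruction`. [cite: MochizukiFrdII2008, Prop. 1.5 (ii) p.13] -/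
theorem prop15_ii (hE : ToP₀EssSurj G D) (hR : ToP₀HomReconstruction G D) :
    IsConnected P ↔ IsConnected (NFLoc.Loc Φ (toP₀ G D)) := by
  haveI : (toP₀ G D).EssSurj := hE
  exact NFLoc.isConnected_iff hR

/-- FrdII Prop. 1.5 (iii) for Example 1.4's `E₀ → P₀`: `P` is totally epimorphic iff `E` is — modulo
`ToP₀Faithful`, `ToP₀EssSurj`, `ToP₀HomReconstruction` and `ETotallyEpimorphic` (Ex. 1.4 (ii)).
[cite: MochizukiFrdII2008, Prop. 1.5 (iii) p.14] -/
theorem prop15_iii (hF : ToP₀Faithful G D) (hE : ToP₀EssSurj G D) (hR : ToP₀HomReconstruction G D)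
    (hT : ETotallyEpimorphic G D) :
    IsTotallyEpimorphic P ↔ IsTotallyEpimorphic (NFLoc.Loc Φ (toP₀ G D)) := by
  haveI : (toP₀ G D).Faithful := hF
  haveI : (toP₀ G D).EssSurj := hE
  exact NFLoc.isTotallyEpimorphic_iff hR hT

/-- FrdII Prop. 1.5 (iv) for Example 1.4's `E₀ → P₀`, the parts that survive (see the erratum note E2 in
`NumberFieldLocalizationsAut.lean`): the first bijection `Aut(P_P → P) ⥲ Aut(E_E → P)` and "`P` slim ⇒
`E` slim" — modulo `ToP₀Faithful`, `ToP₀EssSurj`, `ToP₀HomReconstruction`.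
[cite: MochizukiFrdII2008, Prop. 1.5 (iv) p.14] -/
theorem prop15_iv (hF : ToP₀Faithful G D) (hE : ToP₀EssSurj G D) (hR : ToP₀HomReconstruction G D) :
    (∀ X : NFLoc.Loc Φ (toP₀ G D), Function.Bijective (NFLoc.autPostToP X)) ∧
      (IsSlim P → IsSlim (NFLoc.Loc Φ (toP₀ G D))) := by
  haveI : (toP₀ G D).Faithful := hF
  haveI : (toP₀ G D).EssSurj := hE
  exact ⟨fun X => NFLoc.autPostToP_bijective hR X, fun hP => NFLoc.isSlim_of_isSlim_fst hR hP⟩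

/-- FrdII Prop. 1.5 (v) for Example 1.4's `E₀ → P₀`: a morphism of `E` is a monomorphism (resp.
fiberwise surjective; an FSM-morphism) iff its projection to `P` is — modulo `ToP₀Faithful`,
`ToP₀EssSurj`, `ToP₀HomReconstruction`. [cite: MochizukiFrdII2008, Prop. 1.5 (v) p.14] -/
theorem prop15_v (hF : ToP₀Faithful G D) (hE : ToP₀EssSurj G D) (hR : ToP₀HomReconstruction G D)
    {X Y : NFLoc.Loc Φ (toP₀ G D)} (φ : X ⟶ Y) :
    (Mono φ ↔ Mono φ.fst) ∧ (IsFiberwiseSurjective φ ↔ IsFiberwiseSurjective φ.fst) ∧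
      (IsFSM φ ↔ IsFSM φ.fst) := by
  haveI : (toP₀ G D).Faithful := hF
  haveI : (toP₀ G D).EssSurj := hE
  exact ⟨NFLoc.mono_iff_fst hR φ, NFLoc.isFiberwiseSurjective_iff_fst hR φ, NFLoc.isFSM_iff_fst hR φ⟩

/-- FrdII Prop. 1.5 (vi) for Example 1.4's `E₀ → P₀`: if `P` is of FSM-type, a morphism of `E` is a
`P`-isomorphism iff it is an FSM-morphism — modulo the same three facts.
[cite: MochizukiFrdII2008, Prop. 1.5 (vi) p.14] -/
theorem prop15_vi (hF : ToP₀Faithful G D) (hE : ToP₀EssSurj G D) (hR : ToP₀HomReconstruction G D)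
    (hP : IsOfFSMType P) {X Y : NFLoc.Loc Φ (toP₀ G D)} (φ : X ⟶ Y) :
    NFLoc.IsProjIso (NFLoc.toP Φ (toP₀ G D)) φ ↔ IsFSM φ := by
  haveI : (toP₀ G D).Faithful := hF
  haveI : (toP₀ G D).EssSurj := hE
  exact NFLoc.isProjIso_iff_isFSM hR hP φ

/-- FrdII Prop. 1.5 (ix), factorisation clause, for Example 1.4's `E₀ → P₀`: if `D_v` is trivial or of
prime order then every factorisation `φ_P = α_P ∘ β_P` in `P` lifts to `E` — modulo the obligation
`PHasTrivialFactorizations`. [cite: MochizukiFrdII2008, Prop. 1.5 (ix) p.14] -/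
theorem prop15_ix (hT : PHasTrivialFactorizations G D) (hD : D = ⊥ ∨ (Nat.card D).Prime)
    {X Y : NFLoc.Loc Φ (toP₀ G D)} (φ : X ⟶ Y) {M : P} (β : X.fst ⟶ M) (α : M ⟶ Y.fst)
    (hφ : β ≫ α = φ.fst) :
    ∃ (X₂ : ECat G D) (γ : Φ.obj M ≅ (toP₀ G D).obj X₂) (βE : X ⟶ CFP.mk M X₂ γ)
      (αE : CFP.mk M X₂ γ ⟶ Y), βE ≫ αE = φ ∧ βE.fst = β ∧ αE.fst = α :=
  NFLoc.exists_lift_factorization (hT hD) φ β α hφ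

end Instances

end NFLocCat

end Literature.AlgebraicGeometry.Frobenioids
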